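import Summits.Ventures.PercRepro.RLSClosedForms

/-!
# C-025 at q = 3: the NEAR-PENCIL family at t = 2 under the lifted rule R₃⁺, every k ≥ 4 and every p ≥ 8 (night-3)

The basis-count rule R₃ (Theorem 25's rule) fails the per-flat inequality (T_2)(p,3) on the near-pencil planes
`G = (k-line) ∪ {a}` for every p ≤ 14 (census minima 0.84–0.86); the lifted rule R₃⁺ — ρ₃ on the six small trace types 𝒯₀,
lexicographic hard max elsewhere — repairs them: the subsets `(j-line) ∪ {a}` with `j ≥ 4` tie with their `x` competitors
`(j-line) ∪ {y}` and receive the share `1/(x+1)`.  This module proves, for EVERY `k ≥ 4` and EVERY `p = n + 4 ≥ 8`, the resulting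
per-flat inequality in its lower-bound form (`nearpencil_t2`):
  `Φ(p,3) · (2^k − 2 − 2k) ≤ C(k,2) · t0 + 3·C(k,3) · t1 + (2^k − 1 − k − C(k,2) − C(k,3)) · tie`

with the witness sums of `RLSClosedForms` (outside points `p − 2 = n + 2`, levels `1 ≤ x ≤ p − 4`): `t0 = t0Sum n` (triples,
`C(k,2)`), `t1 = t1Sum n` (pure share of a lined 4-set, ≤ its true share `3/(C(x+4,3) − 1)`; `C(k,3)`), `tie = tieSum n`
(the `2^k − 1 − k − C(k,2) − C(k,3)` subsets with `j ≥ 4`), `Φ(p,3) = Σ_x C(p,x)/C(x+3,3)`; demand `#{B' : |G ∖ B'| ≥ 2} = 2^k − 2 − 2k`.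

Method (certificate lifting): closed forms in `n`, `2^n`; supply − demand = `F k = 2^k·A + C(k,2)·B + C(k,3)·C + (k+1)·D`
(`A = tie − Φ`, `B = t0 − tie ≤ 0`, `C = 3·t1 − tie ≤ 0`, `D = 2Φ − tie`); `F 4`, `F 5 ≥ 0` and the growth bound `32A + 5B + 10C ≥ |D|`
are `(2^n·P(m) + Q(m))/L(m) ≥ 0` (`n = m + 5`, all coefficients positive: `positivity`), exact rationals at `n = 4`;
`B, C ≤ 0` via `2^(m+4) ≥ 16(m+1)`; then induction on `k` (`incr_nonneg`, `F_nonneg`).  No `decide`, no tables.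
-/

open PercRepro.NightThree.CF

namespace PercRepro.NightThree.NP

open Finset
/-! ## Polynomial forms of the closed forms -/

/-- `C(N,2) = N(N−1)/2` in `ℚ`. -/
theorem choose_two_cast (N : ℕ) : (N.choose 2 : ℚ) = (N : ℚ) * ((N : ℚ) - 1) / 2 := by
  induction N with
  | zero => simp
  | succ m ih =>
    rw [Nat.choose_succ_succ', Nat.choose_one_right]
    push_cast
    rw [ih]; ring

/-- `C(N,3) = N(N−1)(N−2)/6` in `ℚ`. -/
theorem choose_three_cast (N : ℕ) : (N.choose 3 : ℚ) = (N : ℚ) * ((N : ℚ) - 1) * ((N : ℚ) - 2) / 6 := by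
  induction N with
  | zero => simp
  | succ m ih =>
    rw [Nat.choose_succ_succ']
    push_cast
    rw [ih, choose_two_cast]; ring

/-- `C(N,4) = N(N−1)(N−2)(N−3)/24` in `ℚ`. -/
theorem choose_four_cast (N : ℕ) : (N.choose 4 : ℚ) = (N : ℚ) * ((N : ℚ) - 1) * ((N : ℚ) - 2) * ((N : ℚ) - 3) / 24 := by
  induction N with
  | zero => simp
  | succ m ih =>
    rw [Nat.choose_succ_succ']
    push_cast
    rw [ih, choose_three_cast]; ring

/-- `Φ(p,3)` as a rational function of `n` and `2^n`. -/
def phiP (n : ℕ) : ℚ :=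
  (128 * 2 ^ n - 2 * (1 + ((n : ℚ) + 7) + ((n : ℚ) + 7) * ((n : ℚ) + 6) / 2 + ((n : ℚ) + 7) * ((n : ℚ) + 6) * ((n : ℚ) + 5) / 6)) /
    (((n : ℚ) + 7) * ((n : ℚ) + 6) * ((n : ℚ) + 5) / 6)

/-- `t0Sum` as a rational function. -/
def t0P (n : ℕ) : ℚ :=
  (32 * 2 ^ n - (2 + 2 * ((n : ℚ) + 5) + ((n : ℚ) + 5) * ((n : ℚ) + 4) / 2 + ((n : ℚ) + 5) * ((n : ℚ) + 4) * ((n : ℚ) + 3) / 6)) /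
    (((n : ℚ) + 5) * ((n : ℚ) + 4) * ((n : ℚ) + 3) / 6)

/-- `t1Sum` as a rational function. -/
def t1P (n : ℕ) : ℚ :=
  t0P n - 3 * (64 * 2 ^ n - 2 - 2 * ((n : ℚ) + 6) - ((n : ℚ) + 6) * ((n : ℚ) + 5) / 2
      - ((n : ℚ) + 6) * ((n : ℚ) + 5) * ((n : ℚ) + 4) / 6 - ((n : ℚ) + 6) * ((n : ℚ) + 5) * ((n : ℚ) + 4) * ((n : ℚ) + 3) / 24) /
    (4 * (((n : ℚ) + 6) * ((n : ℚ) + 5) * ((n : ℚ) + 4) * ((n : ℚ) + 3) / 24))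

/-- `tieSum` as a rational function. -/
def tieP (n : ℕ) : ℚ := (8 * 2 ^ n - 2 * (n : ℚ) - 8) / ((n : ℚ) + 3)

/-- `phiClosed` as an explicit rational function of `n` and `2^n`. -/
theorem phiClosed_eq_phiP (n : ℕ) : phiClosed n = phiP n := by
  unfold phiClosed phiP
  rw [choose_three_cast, choose_two_cast]
  push_cast
  rw [pow_add]
  ring_nf

/-- `t0Sum` as an explicit rational function. -/
theorem t0_eq_t0P (n : ℕ) : t0Sum n = t0P n := by
  rw [t0_closed]; unfold t0P
  rw [choose_three_cast, choose_two_cast]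
  push_cast
  rw [pow_add]
  ring_nf

/-- `t1Sum` as an explicit rational function. -/
theorem t1_eq_t1P (n : ℕ) : t1Sum n = t1P n := by
  rw [t1_closed, t0_eq_t0P]; unfold t1P
  rw [choose_four_cast, choose_three_cast, choose_two_cast]
  push_cast
  rw [pow_add]
  ring_nf

/-- `tieSum` as an explicit rational function. -/
theorem tie_eq_tieP (n : ℕ) : tieSum n = tieP n := by
  rw [tie_closed]; unfold tieP
  rw [pow_add]
  ring_nf

/-! ## The n-inequalities (n = m + 5, resp. m + 4) by positivity of explicit polynomials -/

/-- The common denominator `L(m) = (n+3)(n+4)(n+5)(n+6)(n+7)` at `n = m + 5`. -/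
def L5 (m : ℕ) : ℚ := ((m : ℚ) + 8) * ((m : ℚ) + 9) * ((m : ℚ) + 10) * ((m : ℚ) + 11) * ((m : ℚ) + 12)

/-- `L5 m > 0`. -/
theorem L5_pos (m : ℕ) : 0 < L5 m := by unfold L5; positivity

/-- (N1) `6·t0 + 12·t1 + tie − 6·Φ ≥ 0` for `n = m + 5` (the k = 4 case of the near-pencil family). -/
theorem N1_ge (m : ℕ) : 0 ≤ 6 * t0P (m + 5) + 12 * t1P (m + 5) + tieP (m + 5) - 6 * phiP (m + 5) := by
  have key : 6 * t0P (m + 5) + 12 * t1P (m + 5) + tieP (m + 5) - 6 * phiP (m + 5) =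
      (2 ^ (m + 5) * ((53568:ℚ) + (23952:ℚ) * (m:ℚ) + (4120:ℚ) * (m:ℚ)^2 + (336:ℚ) * (m:ℚ)^3 + (8:ℚ) * (m:ℚ)^4) +
        ((158112:ℚ) + (84744:ℚ) * (m:ℚ) + (16902:ℚ) * (m:ℚ)^2 + (1559:ℚ) * (m:ℚ)^3 + (66:ℚ) * (m:ℚ)^4 + (1:ℚ) * (m:ℚ)^5)) / L5 m := by
    simp only [t1P, t0P, tieP, phiP, L5]
    push_cast
    have h8 : (m : ℚ) + 5 + 3 ≠ 0 := by positivity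
    have h9 : (m : ℚ) + 5 + 4 ≠ 0 := by positivity
    have h10 : (m : ℚ) + 5 + 5 ≠ 0 := by positivity
    have h11 : (m : ℚ) + 5 + 6 ≠ 0 := by positivity
    have h12 : (m : ℚ) + 5 + 7 ≠ 0 := by positivity
    have h8' : (m : ℚ) + 8 ≠ 0 := by positivity
    have h9' : (m : ℚ) + 9 ≠ 0 := by positivity
    have h10' : (m : ℚ) + 10 ≠ 0 := by positivity
    have h11' : (m : ℚ) + 11 ≠ 0 := by positivity
    have h12' : (m : ℚ) + 12 ≠ 0 := by positivity
    field_simp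
    ring
  rw [key]
  have := L5_pos m
  positivity

/-- (N2) `10·t0 + 30·t1 + 6·tie − 20·Φ ≥ 0` for `n = m + 5` (the k = 5 case). -/
theorem N2_ge (m : ℕ) : 0 ≤ 10 * t0P (m + 5) + 30 * t1P (m + 5) + 6 * tieP (m + 5) - 20 * phiP (m + 5) := by
  have key : 10 * t0P (m + 5) + 30 * t1P (m + 5) + 6 * tieP (m + 5) - 20 * phiP (m + 5) =
      (2 ^ (m + 5) * ((63360:ℚ) + (100704:ℚ) * (m:ℚ) + (23952:ℚ) * (m:ℚ)^2 + (2016:ℚ) * (m:ℚ)^3 + (48:ℚ) * (m:ℚ)^4) + ((1679040:ℚ) + (794196:ℚ) * (m:ℚ) + (148017:ℚ) * (m:ℚ)^2 + ((27027:ℚ)/2) * (m:ℚ)^3 + (603:ℚ) * (m:ℚ)^4 + ((21:ℚ)/2) * (m:ℚ)^5)) / L5 m := by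
    simp only [t1P, t0P, tieP, phiP, L5]
    push_cast
    have h8 : (m : ℚ) + 5 + 3 ≠ 0 := by positivity
    have h9 : (m : ℚ) + 5 + 4 ≠ 0 := by positivity
    have h10 : (m : ℚ) + 5 + 5 ≠ 0 := by positivity
    have h11 : (m : ℚ) + 5 + 6 ≠ 0 := by positivity
    have h12 : (m : ℚ) + 5 + 7 ≠ 0 := by positivity
    have h8' : (m : ℚ) + 8 ≠ 0 := by positivity
    have h9' : (m : ℚ) + 9 ≠ 0 := by positivity
    have h10' : (m : ℚ) + 10 ≠ 0 := by positivity
    have h11' : (m : ℚ) + 11 ≠ 0 := by positivity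
    have h12' : (m : ℚ) + 12 ≠ 0 := by positivity
    field_simp
    ring
  rw [key]
  have := L5_pos m
  positivity

/-- (N3) `16·tie + 5·t0 + 30·t1 − 34·Φ ≥ 0` for `n = m + 5` (the growth condition of the k-induction at k = 5). -/
theorem N3_ge (m : ℕ) : 0 ≤ 16 * tieP (m + 5) + 5 * t0P (m + 5) + 30 * t1P (m + 5) - 34 * phiP (m + 5) := by
  have key : 16 * tieP (m + 5) + 5 * t0P (m + 5) + 30 * t1P (m + 5) - 34 * phiP (m + 5) =
      (2 ^ (m + 5) * ((112896:ℚ) + (262080:ℚ) * (m:ℚ) + (64960:ℚ) * (m:ℚ)^2 + (5376:ℚ) * (m:ℚ)^3 + (128:ℚ) * (m:ℚ)^4) + ((3897864:ℚ) + (1801782:ℚ) * (m:ℚ) + (329832:ℚ) * (m:ℚ)^2 + ((59653:ℚ)/2) * (m:ℚ)^3 + (1332:ℚ) * (m:ℚ)^4 + ((47:ℚ)/2) * (m:ℚ)^5)) / L5 m := by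
    simp only [t1P, t0P, tieP, phiP, L5]
    push_cast
    have h8 : (m : ℚ) + 5 + 3 ≠ 0 := by positivity
    have h9 : (m : ℚ) + 5 + 4 ≠ 0 := by positivity
    have h10 : (m : ℚ) + 5 + 5 ≠ 0 := by positivity
    have h11 : (m : ℚ) + 5 + 6 ≠ 0 := by positivity
    have h12 : (m : ℚ) + 5 + 7 ≠ 0 := by positivity
    have h8' : (m : ℚ) + 8 ≠ 0 := by positivity
    have h9' : (m : ℚ) + 9 ≠ 0 := by positivity
    have h10' : (m : ℚ) + 10 ≠ 0 := by positivity
    have h11' : (m : ℚ) + 11 ≠ 0 := by positivity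
    have h12' : (m : ℚ) + 12 ≠ 0 := by positivity
    field_simp
    ring
  rw [key]
  have := L5_pos m
  positivity

/-- The common denominator at `n = m + 4`. -/
def L4 (m : ℕ) : ℚ := ((m : ℚ) + 7) * ((m : ℚ) + 8) * ((m : ℚ) + 9) * ((m : ℚ) + 10) * ((m : ℚ) + 11)

/-- `L4 m > 0`. -/
theorem L4_pos (m : ℕ) : 0 < L4 m := by unfold L4; positivity

/-- `2^(m+4) ≥ 16 (m + 1)`. -/
theorem two_pow_ge_lin (m : ℕ) : 16 * ((m : ℚ) + 1) ≤ 2 ^ (m + 4) := by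
  have h : ((m : ℚ) + 1) ≤ 2 ^ m := by exact_mod_cast Nat.lt_two_pow_self (n := m)
  rw [pow_add]; norm_num; linarith

/-- `tie ≥ t0` for `n = m + 4` (the tie share dominates the triple share). -/
theorem tie_ge_t0 (m : ℕ) : t0P (m + 4) ≤ tieP (m + 4) := by
  have key : tieP (m + 4) - t0P (m + 4) =
      (2 ^ (m + 4) * ((42240:ℚ) + (23024:ℚ) * (m:ℚ) + (4120:ℚ) * (m:ℚ)^2 + (304:ℚ) * (m:ℚ)^3 + (8:ℚ) * (m:ℚ)^4) + ((-34320:ℚ) + (-24372:ℚ) * (m:ℚ) + (-6244:ℚ) * (m:ℚ)^2 + (-755:ℚ) * (m:ℚ)^3 + (-44:ℚ) * (m:ℚ)^4 + (-1:ℚ) * (m:ℚ)^5)) / L4 m := by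
    simp only [t0P, tieP, L4]
    push_cast
    have h7 : (m : ℚ) + 4 + 3 ≠ 0 := by positivity
    have h8 : (m : ℚ) + 4 + 4 ≠ 0 := by positivity
    have h9 : (m : ℚ) + 4 + 5 ≠ 0 := by positivity
    have h10 : (m : ℚ) + 4 + 6 ≠ 0 := by positivity
    have h11 : (m : ℚ) + 4 + 7 ≠ 0 := by positivity
    have h7' : (m : ℚ) + 7 ≠ 0 := by positivity
    have h8' : (m : ℚ) + 8 ≠ 0 := by positivity
    have h9' : (m : ℚ) + 9 ≠ 0 := by positivity
    have h10' : (m : ℚ) + 10 ≠ 0 := by positivity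
    have h11' : (m : ℚ) + 11 ≠ 0 := by positivity
    field_simp
    ring
  have hP : 0 ≤ ((42240:ℚ) + (23024:ℚ) * (m:ℚ) + (4120:ℚ) * (m:ℚ)^2 + (304:ℚ) * (m:ℚ)^3 + (8:ℚ) * (m:ℚ)^4) := by positivity
  have hE := two_pow_ge_lin m
  have hprod : 16 * ((m : ℚ) + 1) * ((42240:ℚ) + (23024:ℚ) * (m:ℚ) + (4120:ℚ) * (m:ℚ)^2 + (304:ℚ) * (m:ℚ)^3 + (8:ℚ) * (m:ℚ)^4) ≤ 2 ^ (m + 4) * ((42240:ℚ) + (23024:ℚ) * (m:ℚ) + (4120:ℚ) * (m:ℚ)^2 + (304:ℚ) * (m:ℚ)^3 + (8:ℚ) * (m:ℚ)^4) :=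
    mul_le_mul_of_nonneg_right hE hP
  have hR : 0 ≤ 16 * ((m : ℚ) + 1) * ((42240:ℚ) + (23024:ℚ) * (m:ℚ) + (4120:ℚ) * (m:ℚ)^2 + (304:ℚ) * (m:ℚ)^3 + (8:ℚ) * (m:ℚ)^4) + ((-34320:ℚ) + (-24372:ℚ) * (m:ℚ) + (-6244:ℚ) * (m:ℚ)^2 + (-755:ℚ) * (m:ℚ)^3 + (-44:ℚ) * (m:ℚ)^4 + (-1:ℚ) * (m:ℚ)^5) := by
    have : 16 * ((m : ℚ) + 1) * ((42240:ℚ) + (23024:ℚ) * (m:ℚ) + (4120:ℚ) * (m:ℚ)^2 + (304:ℚ) * (m:ℚ)^3 + (8:ℚ) * (m:ℚ)^4) + ((-34320:ℚ) + (-24372:ℚ) * (m:ℚ) + (-6244:ℚ) * (m:ℚ)^2 + (-755:ℚ) * (m:ℚ)^3 + (-44:ℚ) * (m:ℚ)^4 + (-1:ℚ) * (m:ℚ)^5) = (641520:ℚ) + (1019852:ℚ) * (m:ℚ) + (428060:ℚ) * (m:ℚ)^2 + (70029:ℚ) * (m:ℚ)^3 + (4948:ℚ) * (m:ℚ)^4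 + (127:ℚ) * (m:ℚ)^5 := by ring
    rw [this]; positivity
  have hL := L4_pos m
  have : 0 ≤ tieP (m + 4) - t0P (m + 4) := by
    rw [key]; apply div_nonneg _ hL.le; linarith
  linarith

/-- `tie ≥ 3·t1` for `n = m + 4` (the tie share dominates the pure 4-set share). -/
theorem tie_ge_3t1 (m : ℕ) : 3 * t1P (m + 4) ≤ tieP (m + 4) := by
  have key : tieP (m + 4) - 3 * t1P (m + 4) =
      (2 ^ (m + 4) * ((38016:ℚ) + (18416:ℚ) * (m:ℚ) + (3736:ℚ) * (m:ℚ)^2 + (304:ℚ) * (m:ℚ)^3 + (8:ℚ) * (m:ℚ)^4) + ((-85338:ℚ) + ((-90371:ℚ)/2) * (m:ℚ) + ((-39295:ℚ)/4) * (m:ℚ)^2 + ((-4293:ℚ)/4) * (m:ℚ)^3 + ((-233:ℚ)/4) * (m:ℚ)^4 + ((-5:ℚ)/4) * (m:ℚ)^5)) / L4 m := by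
    simp only [t1P, t0P, tieP, L4]
    push_cast
    have h7 : (m : ℚ) + 4 + 3 ≠ 0 := by positivity
    have h8 : (m : ℚ) + 4 + 4 ≠ 0 := by positivity
    have h9 : (m : ℚ) + 4 + 5 ≠ 0 := by positivity
    have h10 : (m : ℚ) + 4 + 6 ≠ 0 := by positivity
    have h11 : (m : ℚ) + 4 + 7 ≠ 0 := by positivity
    have h7' : (m : ℚ) + 7 ≠ 0 := by positivity
    have h8' : (m : ℚ) + 8 ≠ 0 := by positivity
    have h9' : (m : ℚ) + 9 ≠ 0 := by positivity
    have h10' : (m : ℚ) + 10 ≠ 0 := by positivity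
    have h11' : (m : ℚ) + 11 ≠ 0 := by positivity
    field_simp
    ring
  have hP : 0 ≤ ((38016:ℚ) + (18416:ℚ) * (m:ℚ) + (3736:ℚ) * (m:ℚ)^2 + (304:ℚ) * (m:ℚ)^3 + (8:ℚ) * (m:ℚ)^4) := by positivity
  have hE := two_pow_ge_lin m
  have hprod : 16 * ((m : ℚ) + 1) * ((38016:ℚ) + (18416:ℚ) * (m:ℚ) + (3736:ℚ) * (m:ℚ)^2 + (304:ℚ) * (m:ℚ)^3 + (8:ℚ) * (m:ℚ)^4) ≤ 2 ^ (m + 4) * ((38016:ℚ) + (18416:ℚ) * (m:ℚ) + (3736:ℚ) * (m:ℚ)^2 + (304:ℚ) * (m:ℚ)^3 + (8:ℚ) * (m:ℚ)^4) :=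
    mul_le_mul_of_nonneg_right hE hP
  have hR : 0 ≤ 16 * ((m : ℚ) + 1) * ((38016:ℚ) + (18416:ℚ) * (m:ℚ) + (3736:ℚ) * (m:ℚ)^2 + (304:ℚ) * (m:ℚ)^3 + (8:ℚ) * (m:ℚ)^4) + ((-85338:ℚ) + ((-90371:ℚ)/2) * (m:ℚ) + ((-39295:ℚ)/4) * (m:ℚ)^2 + ((-4293:ℚ)/4) * (m:ℚ)^3 + ((-233:ℚ)/4) * (m:ℚ)^4 + ((-5:ℚ)/4) * (m:ℚ)^5) := by
    have : 16 * ((m : ℚ) + 1) * ((38016:ℚ) + (18416:ℚ) * (m:ℚ) + (3736:ℚ) * (m:ℚ)^2 + (304:ℚ) * (m:ℚ)^3 + (8:ℚ) * (m:ℚ)^4) + ((-85338:ℚ) + ((-90371:ℚ)/2) * (m:ℚ) + ((-39295:ℚ)/4) * (m:ℚ)^2 + ((-4293:ℚ)/4) * (m:ℚ)^3 + ((-233:ℚ)/4) * (m:ℚ)^4 + ((-5:ℚ)/4) * (m:ℚ)^5) = (522918:ℚ) + ((1715453:ℚ)/2) * (m:ℚ) + ((1378433:ℚ)/4) * (m:ℚ)^2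 + ((254267:ℚ)/4) * (m:ℚ)^3 + ((19735:ℚ)/4) * (m:ℚ)^4 + ((507:ℚ)/4) * (m:ℚ)^5 := by ring
    rw [this]; positivity
  have hL := L4_pos m
  have : 0 ≤ tieP (m + 4) - 3 * t1P (m + 4) := by
    rw [key]; apply div_nonneg _ hL.le; linarith
  linarith

/-! ## n = 4 (p = 8) exactly -/

/-- (N1) at `n = 4` (`p = 8`), exact rationals. -/
theorem N1_four : 0 ≤ 6 * t0P 4 + 12 * t1P 4 + tieP 4 - 6 * phiP 4 := by
  simp only [t1P, t0P, tieP, phiP]; norm_num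

/-- (N2) at `n = 4`, exact rationals. -/
theorem N2_four : 0 ≤ 10 * t0P 4 + 30 * t1P 4 + 6 * tieP 4 - 20 * phiP 4 := by
  simp only [t1P, t0P, tieP, phiP]; norm_num

/-- (N3) at `n = 4`, exact rationals. -/
theorem N3_four : 0 ≤ 16 * tieP 4 + 5 * t0P 4 + 30 * t1P 4 - 34 * phiP 4 := by
  simp only [t1P, t0P, tieP, phiP]; norm_num

/-! ## The k-machinery: `F k = 2^k A + C(k,2) B + C(k,3) C + (k+1) D` -/

/-- The supply-minus-demand of a near-pencil family as a function of `k`, with `p`-constants `A, B, C, D, E`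
(at `t = 2`: `A = tie − Φ`, `B = t0 − tie`, `C = 3 t1 − tie`, `D = 2Φ − tie`, `E = 0`; the constant `E` serves `t = 1`). -/
def F (A B C D E : ℚ) (k : ℕ) : ℚ := 2 ^ k * A + (k.choose 2 : ℚ) * B + (k.choose 3 : ℚ) * C + ((k : ℚ) + 1) * D + E

/-- Pascal: `F (k+1) = F k + (2^k A + k B + C(k,2) C + D)`. -/
theorem F_succ (A B C D E : ℚ) (k : ℕ) :
    F A B C D E (k + 1) = F A B C D E k + (2 ^ k * A + (k : ℚ) * B + (k.choose 2 : ℚ) * C + D) := by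
  unfold F
  rw [Nat.choose_succ_succ' k 1, Nat.choose_succ_succ' k 2, Nat.choose_one_right]
  push_cast
  ring

/-- `k ≤ C(k,2)` for `k ≥ 3`. -/
theorem le_choose_two (k : ℕ) (hk : 3 ≤ k) : (k : ℚ) ≤ (k.choose 2 : ℚ) := by
  rw [choose_two_cast]
  have : (3 : ℚ) ≤ k := by exact_mod_cast hk
  nlinarith

/-- The increment bound propagates: if `G 5 ≥ 0` then `G k ≥ 0` for all `k ≥ 5`, where
`G k = 2^k A + k B + C(k,2) C − |D|` (`B, C ≤ 0`). -/
theorem incr_nonneg (A B C D : ℚ) (hB : B ≤ 0) (hC : C ≤ 0)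
    (h5 : 0 ≤ 2 ^ 5 * A + 5 * B + (Nat.choose 5 2 : ℚ) * C - |D|) :
    ∀ k : ℕ, 5 ≤ k → 0 ≤ 2 ^ k * A + (k : ℚ) * B + (k.choose 2 : ℚ) * C - |D| := by
  intro k hk
  induction k, hk using Nat.le_induction with
  | base => simpa using h5
  | succ j hj ih =>
    have hj' : (5 : ℚ) ≤ j := by exact_mod_cast hj
    have e1 : ((j + 1 : ℕ) : ℚ) * B ≥ 2 * ((j : ℚ) * B) := by
      push_cast; nlinarith
    have hc2 : ((j + 1).choose 2 : ℚ) = (j.choose 2 : ℚ) + j := by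
      rw [Nat.choose_succ_succ' j 1, Nat.choose_one_right]; push_cast; ring
    have e2 : ((j + 1).choose 2 : ℚ) * C ≥ 2 * ((j.choose 2 : ℚ) * C) := by
      rw [hc2]
      have := le_choose_two j (by omega)
      nlinarith
    have e3 : (2 : ℚ) ^ (j + 1) * A = 2 * (2 ^ j * A) := by ring
    have e4 : -|D| ≥ 2 * (-|D|) := by have := abs_nonneg D; linarith
    linarith

/-- Main k-lemma: `F 4 ≥ 0`, `F 5 ≥ 0`, `B, C ≤ 0` and the increment bound at 5 give `F k ≥ 0` for all `k ≥ 4`. -/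
theorem F_nonneg (A B C D E : ℚ) (hB : B ≤ 0) (hC : C ≤ 0)
    (h4 : 0 ≤ F A B C D E 4) (h5 : 0 ≤ F A B C D E 5)
    (hG : 0 ≤ 2 ^ 5 * A + 5 * B + (Nat.choose 5 2 : ℚ) * C - |D|) :
    ∀ k : ℕ, 4 ≤ k → 0 ≤ F A B C D E k := by
  intro k hk
  rcases Nat.lt_or_ge k 5 with h | h
  · have : k = 4 := by omega
    rw [this]; exact h4
  · induction k, h using Nat.le_induction with
    | base => exact h5
    | succ j hj ih =>
      rw [F_succ]
      have hG' := incr_nonneg A B C D hB hC hG j hj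
      have hD : D ≥ -|D| := neg_abs_le D
      have : 0 ≤ 2 ^ j * A + (j : ℚ) * B + (j.choose 2 : ℚ) * C + D := by linarith
      have := ih (by omega)
      linarith

/-! ## The near-pencil family at t = 2 -/

/-- `Φ(p,3) ≥ 0` (it is a sum of nonnegative terms). -/
theorem phiP_nonneg (n : ℕ) : 0 ≤ phiP n := by
  rw [← phiClosed_eq_phiP, ← phi_closed]
  apply sum_nonneg
  intro i _
  positivity

/-- `tie ≥ 0` (a sum of nonnegative terms). -/
theorem tieP_nonneg (n : ℕ) : 0 ≤ tieP n := by
  rw [← tie_eq_tieP]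
  unfold tieSum
  apply sum_nonneg
  intro i _
  positivity

/-- **The near-pencil family at `t = 2` under `R₃⁺`, every `k ≥ 4` and every `p = n + 4 ≥ 8`** (rational-function form):
`Φ(p,3)·(2^k − 2 − 2k) ≤ C(k,2)·t0 + 3·C(k,3)·t1 + (2^k − 1 − k − C(k,2) − C(k,3))·tie`. -/
theorem nearpencil_t2_P (n k : ℕ) (hn : 4 ≤ n) (hk : 4 ≤ k) :
    phiP n * (2 ^ k - 2 - 2 * (k : ℚ)) ≤
      (k.choose 2 : ℚ) * t0P n + 3 * (k.choose 3 : ℚ) * t1P n +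
        (2 ^ k - 1 - (k : ℚ) - (k.choose 2 : ℚ) - (k.choose 3 : ℚ)) * tieP n := by
  obtain ⟨m, rfl⟩ : ∃ m, n = m + 4 := ⟨n - 4, by omega⟩
  set A := tieP (m + 4) - phiP (m + 4) with hA
  set B := t0P (m + 4) - tieP (m + 4) with hB
  set C := 3 * t1P (m + 4) - tieP (m + 4) with hC
  set D := 2 * phiP (m + 4) - tieP (m + 4) with hD
  have key : (k.choose 2 : ℚ) * t0P (m + 4) + 3 * (k.choose 3 : ℚ) * t1P (m + 4) +
        (2 ^ k - 1 - (k : ℚ) - (k.choose 2 : ℚ) - (k.choose 3 : ℚ)) * tieP (m + 4) -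
      phiP (m + 4) * (2 ^ k - 2 - 2 * (k : ℚ)) = F A B C D 0 k := by
    unfold F; rw [hA, hB, hC, hD]; ring
  have hB0 : B ≤ 0 := by rw [hB]; linarith [tie_ge_t0 m]
  have hC0 : C ≤ 0 := by rw [hC]; linarith [tie_ge_3t1 m]
  have hPhi := phiP_nonneg (m + 4)
  have hTie := tieP_nonneg (m + 4)
  have habs : |D| ≤ 2 * phiP (m + 4) + tieP (m + 4) := by
    rw [hD, abs_le]; constructor <;> linarith
  -- the three n-inequalities
  have hN1 : 0 ≤ 6 * t0P (m + 4) + 12 * t1P (m + 4) + tieP (m + 4) - 6 * phiP (m + 4) := by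
    rcases m with _ | m'
    · exact N1_four
    · have := N1_ge m'; rwa [show m' + 1 + 4 = m' + 5 by omega]
  have hN2 : 0 ≤ 10 * t0P (m + 4) + 30 * t1P (m + 4) + 6 * tieP (m + 4) - 20 * phiP (m + 4) := by
    rcases m with _ | m'
    · exact N2_four
    · have := N2_ge m'; rwa [show m' + 1 + 4 = m' + 5 by omega]
  have hN3 : 0 ≤ 16 * tieP (m + 4) + 5 * t0P (m + 4) + 30 * t1P (m + 4) - 34 * phiP (m + 4) := by
    rcases m with _ | m'
    · exact N3_four
    · have := N3_ge m'; rwa [show m' + 1 + 4 = m' + 5 by omega]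
  have h4 : 0 ≤ F A B C D 0 4 := by
    unfold F; rw [hA, hB, hC, hD]; norm_num [Nat.choose]; linarith
  have h5 : 0 ≤ F A B C D 0 5 := by
    unfold F; rw [hA, hB, hC, hD]; norm_num [Nat.choose]; linarith
  have hG : 0 ≤ 2 ^ 5 * A + 5 * B + (Nat.choose 5 2 : ℚ) * C - |D| := by
    rw [hA, hB, hC]; norm_num [Nat.choose]; linarith
  have := F_nonneg A B C D 0 hB0 hC0 h4 h5 hG k hk
  linarith

/-- **The near-pencil family at `t = 2` under `R₃⁺`** in terms of the sums: for the plane `G = (k-line) ∪ {a}`, every `k ≥ 4`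
and every `p = n + 4 ≥ 8`, the R₃⁺ supply lower bound (triples `C(k,2)` with share `1/C(x+3,3)`, lined 4-sets `C(k,3)` with
share `≥ 3/C(x+4,3)`, the `2^k − 1 − k − C(k,2) − C(k,3)` subsets `(j-line) ∪ {a}`, `j ≥ 4`, with the hard-max tie share
`1/(x+1)`, witnesses `C(p−2,x)`, `1 ≤ x ≤ p − 4`) is at least `Φ(p,3)` times the demand `#{B' : |G ∖ B'| ≥ 2} = 2^k − 2 − 2k`. -/
theorem nearpencil_t2 (n k : ℕ) (hn : 4 ≤ n) (hk : 4 ≤ k) :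
    (∑ i ∈ range n, ((n + 4).choose (i + 1) : ℚ) / ((i + 4).choose 3 : ℚ)) * (2 ^ k - 2 - 2 * (k : ℚ)) ≤
      (k.choose 2 : ℚ) * t0Sum n + 3 * (k.choose 3 : ℚ) * t1Sum n +
        (2 ^ k - 1 - (k : ℚ) - (k.choose 2 : ℚ) - (k.choose 3 : ℚ)) * tieSum n := by
  rw [phi_closed, phiClosed_eq_phiP, t0_eq_t0P, t1_eq_t1P, tie_eq_tieP]
  exact nearpencil_t2_P n k hn hk

end PercRepro.NightThree.NP
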